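import Summits.CriticalPhenomena.SAWScalingLimit.Theses.SAWWeldingIdentification
import Summits.CriticalPhenomena.SAWScalingLimit.Theorems.SAWRenewalTightnessTightOfShellCrossing
import Literature.Probability.RandomPlanarGeometry.CurvePVariation
import HarnessLib

/-!
# `NoReturnTightU → EventualTight` — the no-return strengthening closes the crux (strategist s3-B)

Crux stmt-CriticalPhenomena-1372 `EventualTight` (bet route `SAWWeldingIdentification`).  Strategist b1
(§Strengthen S_A) and instance A of seat s3 (`StrategistSketch_s3.lean`: `NoFjordAllScales →
NoReturnTight`) typed the NO-RETURN strengthening of eventual tightness and described its glue to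
the crux as an informal pigeonhole.  This file PROVES that glue, for the uniform-threshold form
`NoReturnTightU` (one `δ₀` per `(D, a, b)`, as in the crux itself; b1/A's form lets `δ₀` depend on
`(ℓ, θ)` and reduces to this one by the standard window argument, not formalised here):

* `tortuosity_le_card_of_not_hasFjord` — deterministic: if a curve covered by `#T` balls of
  radius `ε/2` has NO `(ε, a)`-fjord (`s < t < u` with the ends `ε`-close and the middle `a`-far),
  `ε < a`, then the Aizenman–Burchard greedy stopping points at scale `a` are pairwise `ε`-far
  (two close stops and the stop after the first of them ARE a fjord), so there are at most `#T`
  of them and the greedy division gives `M(γ, 2a) ≤ #T`;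
* `eventualTight_of_noReturnTightU` — with the tree's AB99 Lemma 4.1
  (`CurveClass.isCompact_closure_image_mk_of_tortuosity_le`) and a geometric series of thresholds.

Nothing here is asserted: `NoReturnTightU` is a STRENGTHENING of the crux (it also forces
simplicity of subsequential limits) with no engine of its own (census §Strengthen).
[cite: AizenmanBurchardDuke1999, Lemma 4.1 and §2.d]
-/

noncomputable section

open MeasureTheory Filter Topology Set Metric
open scoped ENNReal NNReal unitInterval
open Literature.Probability.RandomPlanarGeometry Literature.Probability.LatticeModels

namespace Summit.CriticalPhenomena.SAWScalingLimit.Cruxes.EventualTight.StrategistS3B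

/-- A parametrised curve has a `(w, ℓ)`-fjord (= b1's `HasReturn`, instance A's `HasFjord`):
three times `s < t < u` with the two ends `w`-close and the middle `ℓ`-far from the first end. -/
def HasFjord (c : I → ℂ) (w ℓ : ℝ) : Prop :=
  ∃ s t u : I, s < t ∧ t < u ∧ dist (c s) (c u) ≤ w ∧ ℓ ≤ dist (c s) (c t)

/-- **`NoReturnTightU`** (no-return tightness, uniform threshold): for every Dobrushin domain and
endpoint approximation there is `δ₀ > 0` such that for every `ℓ > 0` and `θ > 0` some `ε > 0`
makes the `(ε, ℓ)`-fjords of the pushed critical SAW polyline carry mass `≤ θ` for ALL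
`δ ∈ (0, δ₀]`. -/
def NoReturnTightU : Prop :=
  ∀ (D : DobrushinDomain) (a b : ℝ → Site 2), SAW.IsEndpointApprox D a b →
    ∃ δ₀ : ℝ, 0 < δ₀ ∧ ∀ ℓ : ℝ, 0 < ℓ → ∀ θ : ℝ, 0 < θ → ∃ ε : ℝ, 0 < ε ∧
      ∀ δ ∈ Set.Ioc (0 : ℝ) δ₀, SAW.law D.carrier δ (a δ) (b δ)
        {γ | HasFjord (fun s => (⟨γ.walk.toCurve (meshPoint δ)⟩ : Curve ℂ) s) ε ℓ} ≤
        ENNReal.ofReal θ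

/-- Fjords are monotone in the closeness parameter. -/
theorem HasFjord.mono {c : I → ℂ} {w w' ℓ : ℝ} (h : HasFjord c w ℓ) (hw : w ≤ w') :
    HasFjord c w' ℓ := by
  obtain ⟨s, t, u, hst, htu, hsu, hfar⟩ := h
  exact ⟨s, t, u, hst, htu, hsu.trans hw, hfar⟩

/-- **Deterministic pigeonhole**: a curve covered by the `ε/2`-balls about the points of `T`, with
no `(ε, a)`-fjord and `ε < a`, has tortuosity `M(γ, 2a) ≤ #T` — the greedy stopping points at scale
`a` are pairwise `ε`-far, hence at most `#T` of them, and the greedy division applies.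
[cite: AizenmanBurchardDuke1999, §2.d (proof of Thm 2.5)] -/
theorem tortuosity_le_card_of_not_hasFjord {γ : Curve ℂ} {a ε : ℝ} (ha : 0 < a) (hεa : ε < a)
    {T : Finset ℂ} (hcov : γ.range ⊆ ⋃ y ∈ T, ball y (ε / 2))
    (hno : ¬ HasFjord γ ε a) : γ.tortuosity (2 * a) ≤ T.card := by
  classical
  have hnot : ¬ γ.IsStop a T.card := by
    intro hstop
    have hmem : ∀ m : ℕ, ∃ y ∈ T, γ (γ.stopSeq a m) ∈ ball y (ε / 2) := fun m ↦ by
      have := hcov ⟨γ.stopSeq a m, rfl⟩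
      simpa only [mem_iUnion, exists_prop] using this
    choose f hfT hfball using hmem
    have hb : ∀ m, dist (γ (γ.stopSeq a m)) (f m) < ε / 2 := fun m ↦ mem_ball.1 (hfball m)
    -- two stopping indices with the same centre give a fjord (or contradict `ε < a`)
    have key : ∀ m m' : ℕ, m < m' → m' ≤ T.card → f m = f m' → False := by
      intro m m' hlt hm'le hfeq
      have hclose : dist (γ (γ.stopSeq a m)) (γ (γ.stopSeq a m')) < ε := by
        calc dist (γ (γ.stopSeq a m)) (γ (γ.stopSeq a m'))
            ≤ dist (γ (γ.stopSeq a m)) (f m) + dist (f m) (γ (γ.stopSeq a m')) :=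
              dist_triangle _ _ _
          _ < ε / 2 + ε / 2 := by
              refine add_lt_add (hb m) ?_
              rw [dist_comm, hfeq]
              exact hb m'
          _ = ε := by ring
      have hstop' : γ.IsStop a m' := hstop.of_le hm'le
      have hstop1 : γ.IsStop a (m + 1) := hstop'.of_le (Nat.succ_le_of_lt hlt)
      have hfar : a ≤ dist (γ (γ.stopSeq a m)) (γ (γ.stopSeq a (m + 1))) := by
        rw [dist_comm]; exact hstop1.le_dist_stopSeq_succ
      rcases Nat.lt_or_ge (m + 1) m' with h2 | h2
      · exact hno ⟨γ.stopSeq a m, γ.stopSeq a (m + 1), γ.stopSeq a m',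
          hstop1.stopSeq_lt_succ ha, hstop'.stopSeq_lt ha h2, hclose.le, hfar⟩
      · have hm' : m' = m + 1 := le_antisymm h2 (Nat.succ_le_of_lt hlt)
        subst hm'
        exact (lt_irrefl a) ((hfar.trans_lt hclose).trans hεa)
    obtain ⟨m, hm, m', hm', hne, hfeq⟩ := Finset.exists_ne_map_eq_of_card_lt_of_maps_to
      (s := Finset.range (T.card + 1)) (t := T) (by simp) (fun m _ ↦ hfT m)
    have hmle : m ≤ T.card := by simpa [Finset.mem_range, Nat.lt_succ_iff] using hm
    have hm'le : m' ≤ T.card := by simpa [Finset.mem_range, Nat.lt_succ_iff] using hm'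
    rcases lt_or_gt_of_ne hne with hlt | hlt
    · exact key m m' hlt hm'le hfeq
    · exact key m' m hlt hmle hfeq.symm
  obtain ⟨k, -, hkle, -, P, hP, hPcard⟩ := Curve.exists_isDivision_of_not_isStop ha hnot
  have := hP.tortuosity_lt_card
  omega

/-- **`NoReturnTightU → EventualTight`** (this route's decl, by name).  For `ε > 0` take scales
`a_i = 2^{-i}`, thresholds `θ_i = ε 2^{-(i+1)}`, closeness `ε_i ≤ a_i / 2` from the hypothesis and
finite `ε_i/2`-nets `T_i` of a disc `Λ` containing all polylines; the compact set is the closure of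
`{range ⊆ Λ, M(γ, 2a_i) ≤ #T_i ∀ i}` (AB99 Lemma 4.1), and its complement is contained in
`⋃_i {(ε_i, a_i)-fjord}` by `tortuosity_le_card_of_not_hasFjord`, of mass `≤ Σ θ_i = ε`.
[cite: AizenmanBurchardDuke1999, Lemma 4.1] -/
theorem eventualTight_of_noReturnTightU (hNR : NoReturnTightU) :
    Summit.CriticalPhenomena.SAWScalingLimit.Theses.SAWWeldingIdentification.EventualTight := by
  intro D a b hab
  classical
  obtain ⟨δ₁, hδ₁, hNR'⟩ := hNR D a b hab
  -- the endpoint `a_δ` is within `1` of the marked point `a` for small `δ`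
  have hnear : ∀ᶠ δ in 𝓝[>] (0 : ℝ), meshPoint δ (a δ) ∈ ball (D.pt 0) 1 :=
    hab.tendsto_fst.eventually_mem (ball_mem_nhds _ one_pos)
  obtain ⟨δ₂, hδ₂, hsub₂⟩ := mem_nhdsGT_iff_exists_Ioo_subset.1 hnear
  have hδ₂' : (0 : ℝ) < δ₂ := hδ₂
  -- a disc containing the domain and the unit disc about `a`
  obtain ⟨r, hr⟩ := D.isBounded.subset_closedBall (0 : ℂ)
  set rΛ : ℝ := max r 0 + ‖D.pt 0‖ + 1 with hrΛ
  have hΩ : D.carrier ⊆ closedBall (0 : ℂ) rΛ := hr.trans (closedBall_subset_closedBall (by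
    rw [hrΛ]; linarith [le_max_left r 0, norm_nonneg (D.pt 0)]))
  have hball : ball (D.pt 0) 1 ⊆ closedBall (0 : ℂ) rΛ := by
    intro z hz
    rw [mem_ball] at hz
    rw [mem_closedBall, dist_zero_right]
    have := norm_le_norm_add_norm_sub' z (D.pt 0)
    rw [← dist_eq_norm] at this
    rw [hrΛ]
    linarith [le_max_right r 0]
  have hΛc : IsCompact (closedBall (0 : ℂ) rΛ) := isCompact_closedBall _ _
  -- the mesh threshold
  set δ₀ : ℝ := min δ₁ (δ₂ / 2) with hδ₀
  have hδ₀pos : 0 < δ₀ := lt_min hδ₁ (half_pos hδ₂')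
  have hδ₀δ₁ : δ₀ ≤ δ₁ := min_le_left _ _
  have hδ₀δ₂ : δ₀ < δ₂ := (min_le_right _ _).trans_lt (half_lt_self hδ₂')
  refine ⟨δ₀, hδ₀pos, ?_⟩
  -- ranges lie in the disc for `δ ∈ (0, δ₀]`
  have hrange : ∀ δ ∈ Set.Ioc (0 : ℝ) δ₀, ∀ γ : SAW.DomainSAW D.carrier δ (a δ) (b δ),
      (⟨γ.walk.toCurve (meshPoint δ)⟩ : Curve ℂ).range ⊆ closedBall 0 rΛ := by
    intro δ hδ γ
    refine Theorems.range_toCurve_domainSAW_subset γ fun q hq ↦ ?_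
    rw [SimpleGraph.Walk.mem_support_iff] at hq
    rcases hq with rfl | hq
    · exact hball (hsub₂ ⟨hδ.1, hδ.2.trans_lt hδ₀δ₂⟩)
    · exact hΩ (meshDomain_subset_meshVertices _ _
        (Theorems.mem_meshDomain_of_mem_tail_support γ.walk q hq))
  -- tightness
  rw [isTightMeasureSet_iff_exists_isCompact_measure_compl_le]
  intro ε hε
  rcases eq_or_ne ε ⊤ with rfl | hεtop
  · exact ⟨∅, isCompact_empty, fun μ _ ↦ le_top⟩
  have hεr : 0 < ε.toReal := ENNReal.toReal_pos hε.ne' hεtop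
  -- scales, thresholds, closeness parameters, nets
  set sc : ℕ → ℝ := fun i ↦ (1 / 2 : ℝ) ^ i with hsc
  have hscpos : ∀ i, 0 < sc i := fun i ↦ by positivity
  set θ : ℕ → ℝ := fun i ↦ ε.toReal * (1 / 2 : ℝ) ^ (i + 1) with hθ
  have hθpos : ∀ i, 0 < θ i := fun i ↦ by positivity
  choose εf hεf hbound using fun i : ℕ ↦ hNR' (sc i) (hscpos i) (θ i) (hθpos i)
  set εc : ℕ → ℝ := fun i ↦ min (εf i) (sc i / 2) with hεc
  have hεcpos : ∀ i, 0 < εc i := fun i ↦ lt_min (hεf i) (half_pos (hscpos i))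
  have hεcsc : ∀ i, εc i < sc i := fun i ↦ (min_le_right _ _).trans_lt (half_lt_self (hscpos i))
  have hεcle : ∀ i, εc i ≤ εf i := fun i ↦ min_le_left _ _
  have hnet : ∀ i, ∃ T : Finset ℂ, closedBall (0 : ℂ) rΛ ⊆ ⋃ y ∈ T, ball y (εc i / 2) := by
    intro i
    obtain ⟨t, -, htfin, htcov⟩ := finite_cover_balls_of_compact hΛc (half_pos (hεcpos i))
    refine ⟨htfin.toFinset, ?_⟩
    simpa only [Set.Finite.mem_toFinset] using htcov
  choose T hT using hnet
  -- the compact set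
  set L : ℕ → ℝ := fun i ↦ 2 * sc i with hL
  set Φ : ℕ → ℕ := fun i ↦ (T i).card with hΦ
  have hLsmall : ∀ η > 0, ∃ i, 0 < L i ∧ L i ≤ η := by
    intro η hη
    obtain ⟨i, hi⟩ := exists_pow_lt_of_lt_one (half_pos hη) (by norm_num : (1 / 2 : ℝ) < 1)
    refine ⟨i, by simp only [hL]; positivity, ?_⟩
    simp only [hL, hsc]
    linarith
  set 𝒦 : Set (Curve ℂ) :=
    {γ | γ.range ⊆ closedBall (0 : ℂ) rΛ ∧ ∀ i, γ.tortuosity (L i) ≤ Φ i} with h𝒦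
  have h𝒦c : IsCompact (closure (CurveClass.mk '' 𝒦)) := by
    have h := CurveClass.isCompact_closure_image_mk_of_tortuosity_le hΛc L Φ hLsmall
    exact h
  refine ⟨closure (CurveClass.mk '' 𝒦), h𝒦c, ?_⟩
  rintro μ ⟨δ, hδ, rfl⟩
  have hδ' : δ ∈ Set.Ioc (0 : ℝ) δ₁ := ⟨hδ.1, hδ.2.trans hδ₀δ₁⟩
  have hmeas : Measurable fun γ : SAW.DomainSAW D.carrier δ (a δ) (b δ) ↦ γ.curve :=
    SAW.DomainSAW.measurable_of_top _
  rw [Measure.map_apply hmeas h𝒦c.isClosed.measurableSet.compl]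
  -- the bad events
  set Bad : ℕ → Set (SAW.DomainSAW D.carrier δ (a δ) (b δ)) := fun i ↦
    {γ | HasFjord (fun s => (⟨γ.walk.toCurve (meshPoint δ)⟩ : Curve ℂ) s) (εc i) (sc i)} with hBad
  have hsub : (fun γ : SAW.DomainSAW D.carrier δ (a δ) (b δ) ↦ γ.curve) ⁻¹'
      (closure (CurveClass.mk '' 𝒦))ᶜ ⊆ ⋃ i, Bad i := by
    intro γ hγ
    simp only [mem_preimage, mem_compl_iff] at hγ
    by_contra hgood
    simp only [mem_iUnion, not_exists] at hgood
    refine hγ (subset_closure ⟨_, ⟨hrange δ hδ γ, fun i ↦ ?_⟩, rfl⟩)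
    exact tortuosity_le_card_of_not_hasFjord (hscpos i) (hεcsc i)
      ((hrange δ hδ γ).trans (hT i)) (hgood i)
  have hBadle : ∀ i, SAW.law D.carrier δ (a δ) (b δ) (Bad i) ≤ ENNReal.ofReal (θ i) := by
    intro i
    refine le_trans (measure_mono fun γ hγ ↦ ?_) (hbound i δ hδ')
    exact HasFjord.mono hγ (hεcle i)
  -- summing the geometric series
  have hθsum : HasSum θ ε.toReal := by
    have h1 : HasSum (fun i : ℕ ↦ (1 / 2 : ℝ) ^ (i + 1)) 1 := by
      have h := (hasSum_geometric_of_lt_one (by norm_num : (0 : ℝ) ≤ 1 / 2)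
        (by norm_num : (1 / 2 : ℝ) < 1)).mul_left (1 / 2)
      have h2 : (1 / 2 : ℝ) * (1 - 1 / 2)⁻¹ = 1 := by norm_num
      rw [h2] at h
      have h3 : (fun i : ℕ ↦ (1 / 2 : ℝ) ^ (i + 1)) = fun i : ℕ ↦ (1 / 2 : ℝ) * (1 / 2) ^ i := by
        funext i
        exact pow_succ' _ _
      rw [h3]
      exact h
    simpa [hθ] using h1.mul_left ε.toReal
  have hθsumm : Summable θ := hθsum.summable
  calc SAW.law D.carrier δ (a δ) (b δ)
        ((fun γ : SAW.DomainSAW D.carrier δ (a δ) (b δ) ↦ γ.curve) ⁻¹' (closure (CurveClass.mk '' 𝒦))ᶜ)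
      ≤ SAW.law D.carrier δ (a δ) (b δ) (⋃ i, Bad i) := measure_mono hsub
    _ ≤ ∑' i, SAW.law D.carrier δ (a δ) (b δ) (Bad i) := measure_iUnion_le _
    _ ≤ ∑' i, ENNReal.ofReal (θ i) := ENNReal.tsum_le_tsum hBadle
    _ = ENNReal.ofReal (∑' i, θ i) :=
        (ENNReal.ofReal_tsum_of_nonneg (fun i ↦ (hθpos i).le) hθsumm).symm
    _ = ε := by rw [hθsum.tsum_eq, ENNReal.ofReal_toReal hεtop]

end Summit.CriticalPhenomena.SAWScalingLimit.Cruxes.EventualTight.StrategistS3B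

end
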